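import Summits.RiemannHypothesis.RiemannHypothesis.Theorems.WeilWindowFlowWindowLipschitzStubComparisonPhase
import Summits.RiemannHypothesis.RiemannHypothesis.Theorems.OddSectorWindowLipschitzEulerLagrangeAll
import Summits.RiemannHypothesis.RiemannHypothesis.Theorems.OddSectorWindowLipschitzSupBound
import HarnessLib

/-!
# Odd-sector window-Lipschitz, PART 3a: the weak maximum principle for one phase
# (`Re ζu ≤ C_sup √(log 1/d₀) · B` a.e.) for odd-sector ground states
# (pub-rhpf, transport-1, leaf G1.22 'TRANSPORT'; RH-free; def-free)

**mechanism/rigidity campaign; no RH claims.**  Companion text: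
`run/shared/lean/pub/pub-rhpf/pub-rhpf-transport-1/TRANSPORT.md` §23 (odd-sector window-Lipschitz).

Odd-sector twin of `WeilWindowFlowWindowLipschitz.stub_comparison_phase` / `stub_comparison` (route
WeilWindowFlow, line `borderline-barrier`, stub S3): if the explicit two-scale barrier
`B(x) = (log(1/min(a − |x|, d₀)))^{-1/2}` lies in the form domain (hypothesis S2a, discharged downstream by
the landed `stub_barrierEnergy`) and is a weak supersolution on the edge layer with surplus `c √(log 1/d₀)`
(hypothesis, discharged downstream by the landed `windowLipschitz_weakSurplus (windowLipschitz_surplus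
stub_surplusReduction stub_surplusCalculus) stub_barrierWeakForm` — all `u`-independent), then ODD-SECTOR
ground states obey the pointwise edge law `‖u(x)‖² · log(1/(a − |x|)) ≤ K(b₀, A)` a.e. on the layer
`a − d₀ < |x| < a`, uniformly for windows `a ∈ [b₀, A]` (`oddComparison`).

Proof: VERBATIM the even files, with the landed odd-sector spine in place of the even one — (C2)
`oddGroundState_finiteEnergy'`, (EL, all directions) `oddGroundState_eulerLagrange_all` (PART 1), (A)
`oddSupBound` (PART 2) — `IsWeilGroundState ↦ IsWeilOddGroundState`, `ε ↦ ε_od`,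
`weilOddGroundEnergy_antitone`; the `u`-independent toolkit (`…StubComparisonAux`, `…StubSupBoundAux`) is
imported.  The test directions `(Re ζu − K₁B)⁺` are NOT odd (PART 1 is what makes the test legitimate).

Labels: PROVED tree material only (RH-free); no hypothesis is an open item.  Nothing here is a step toward RH.

References: H. Chen, T. Weth, CPDE 44 (2019), arXiv:1710.03416, §§3–4; V. Hernández-Santamaría,
L. F. López Ríos, A. Saldaña, arXiv:2401.18033, Thm 1.1 / 2.4; P. A. Feulefack, S. Jarohs, T. Weth,
arXiv:2010.10448, §3; E. Bombieri, Rend. Mat. Acc. Lincei (9) 11 (2000), §4.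
-/

set_option linter.dupNamespace false  -- D-0017 nested layout: `RiemannHypothesis.RiemannHypothesis`

noncomputable section

open MeasureTheory Set Filter
open scoped Topology ENNReal NNReal ComplexConjugate

namespace Summit.RiemannHypothesis.RiemannHypothesis.Theorems.OddSectorWindowLipschitz

open Literature.NumberTheory.LFunctions
open Summit.RiemannHypothesis.RiemannHypothesis.Theorems.WeilWindowFlowWindowLipschitz

/-! ## `‖u‖₁` -/

/-- `‖u‖₁ ≤ a + 1/2` for an odd-sector ground state of the window `[-a, a]` vanishing off the window
(`|u| ≤ (1 + |u|²)/2`, `∫|u|² = 1`). [folklore] -/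
private theorem oddComparison_l1_le {a : ℝ} {u : ℝ → ℂ} (hu : IsWeilOddGroundState a u)
    (hu0 : ∀ x, x ∉ Icc (-a) a → u x = 0) : ∫ x, ‖u x‖ ≤ a + 1 / 2 := by
  have ha := hu.pos
  have h2 : Integrable (fun x ↦ ‖u x‖ ^ 2) :=
    (memLp_two_iff_integrable_sq_norm hu.memLp.1).1 hu.memLp
  have hind : Integrable ((Icc (-a) a).indicator (fun _ ↦ (1 : ℝ))) :=
    (integrable_indicator_iff measurableSet_Icc).2
      (integrableOn_const (by rw [Real.volume_Icc]; exact ENNReal.ofReal_ne_top))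
  calc ∫ x, ‖u x‖ ≤ ∫ x, ((Icc (-a) a).indicator (fun _ ↦ (1 : ℝ)) x + ‖u x‖ ^ 2) / 2 := by
        refine integral_mono hu.integrable.norm ((hind.add h2).div_const 2) fun x ↦ ?_
        by_cases hx : x ∈ Icc (-a) a
        · dsimp only
          rw [indicator_of_mem hx]
          nlinarith [sq_nonneg (‖u x‖ - 1)]
        · simp [hu0 x hx, hx]
    _ = (volume.real (Icc (-a) a) + ∫ x, ‖u x‖ ^ 2) / 2 := by
        rw [integral_div, integral_add hind h2, integral_indicator_const _ measurableSet_Icc,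
          smul_eq_mul, mul_one]
    _ = a + 1 / 2 := by
        rw [hu.integral_norm_sq, Real.volume_real_Icc_of_le (by linarith)]
        ring

/-! ## One phase: `Re v ≤ K₁ B` a.e. -/

/-- **The weak maximum principle for one phase, odd sector** (odd twin of
`WeilWindowFlowWindowLipschitz.stub_comparison_phase`). For an odd-sector ground state `v` of a window
`a ∈ [b₀, A]`
vanishing off the window with `‖v‖ ≤ C_sup` a.e., a barrier `B` (`0 ≤ B ≤ β₀ = (log 1/d₀)^{-1/2}`,
`= β₀` on the plateau `|x| ≤ a − d₀`, `= 0` off the open window, in the form domain) whose weak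
surplus on the layer is `c √(log 1/d₀)`, and `c·log(1/d₀) ≥ C_F + 1` with
`C_F ≥ |M_a| + |ε_od(a)| + 4e^{2A}(A + 1/2) + 2 S_a`: `Re v ≤ C_sup √(log 1/d₀) · B` a.e.
(test (EL) against `(Re v − C_sup√(log 1/d₀) B)⁺`). [folklore] -/
theorem oddComparison_phase {a A d₀ c Csup CF : ℝ} {B : ℝ → ℝ} {v : ℝ → ℂ}
    (haA : a ≤ A) (hd₀ : 0 < d₀) (hd₀1 : d₀ < 1)
    (hv : IsWeilOddGroundState a v) (hv0 : ∀ x, x ∉ Icc (-a) a → v x = 0)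
    (hCsup1 : 1 ≤ Csup) (hvb : ∀ᵐ x : ℝ, ‖v x‖ ≤ Csup)
    (hBm : Measurable B) (hBb : ∀ x, 0 ≤ B x ∧ B x ≤ 1 / Real.sqrt (Real.log (1 / d₀)))
    (hB0 : ∀ x, a ≤ |x| → B x = 0)
    (hBp : ∀ x, |x| ≤ a - d₀ → B x = 1 / Real.sqrt (Real.log (1 / d₀)))
    (hB2 : MemLp (fun x ↦ (B x : ℂ)) 2)
    (hBE : IntegrableOn (fun t ↦ weilArchDensity t * weilIncrement (fun x ↦ (B x : ℂ)) t) (Ioi 0))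
    (hweak : ∀ w : ℝ → ℝ, MemLp w 2 → (∀ᵐ x : ℝ, 0 ≤ w x) →
        (∀ᵐ x : ℝ, ¬(a - d₀ < |x| ∧ |x| < a) → w x = 0) →
        c * Real.sqrt (Real.log (1 / d₀)) * ∫ x, w x ≤
          ∫ t in Ioi (0 : ℝ), weilArchDensity t * ∫ x, (B (x + t) - B x) * (w (x + t) - w x))
    (hCF : |weilMarkovConstant a| + |weilOddGroundEnergy a| + 4 * Real.exp A ^ 2 * (A + 1 / 2) +
        2 * (∑ n ∈ weilPrimeIndex a, (ArithmeticFunction.vonMangoldt n : ℝ) / Real.sqrt n) ≤ CF)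
    (hL₀ : CF + 1 ≤ c * Real.log (1 / d₀)) :
    ∀ᵐ x : ℝ, (v x).re ≤ Csup * Real.sqrt (Real.log (1 / d₀)) * B x := by
  -- constants
  set L₀ : ℝ := Real.log (1 / d₀) with hL₀def
  set sL : ℝ := Real.sqrt L₀ with hsLdef
  set K₁ : ℝ := Csup * sL with hK₁def
  have hL₀pos : 0 < L₀ := Real.log_pos (by rw [lt_div_iff₀ hd₀]; linarith)
  have hsL : 0 < sL := Real.sqrt_pos.2 hL₀pos
  have hsL2 : sL ^ 2 = L₀ := Real.sq_sqrt hL₀pos.le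
  have hCsup0 : 0 < Csup := by linarith
  have hK₁ : 0 ≤ K₁ := by positivity
  have hK₁β₀ : K₁ * (1 / sL) = Csup := by
    rw [hK₁def]; field_simp
  -- the test function `W = (Re v − K₁ B)⁺`
  set W : ℝ → ℝ := fun x ↦ max ((v x).re - K₁ * B x) 0 with hW
  have hWdef : ∀ x, W x = max ((v x).re - K₁ * B x) 0 := fun x ↦ rfl
  have hW0 : ∀ x, 0 ≤ W x := fun x ↦ le_max_right _ _
  have hWle : ∀ x, W x ≤ ‖v x‖ := fun x ↦
    max_le (by linarith [Complex.abs_re_le_norm (v x), le_abs_self ((v x).re),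
      mul_nonneg hK₁ (hBb x).1]) (norm_nonneg _)
  have hWsupp : ∀ x, x ∉ Icc (-a) a → W x = 0 := by
    intro x hx
    have hxa : a ≤ |x| := by
      rw [mem_Icc, not_and_or, not_le, not_le] at hx
      rcases hx with h | h
      · rw [abs_of_neg (by linarith [hv.pos])]; linarith
      · rw [abs_of_pos (by linarith [hv.pos])]; linarith
    rw [hWdef, hv0 x hx, hB0 x hxa, Complex.zero_re, mul_zero, sub_zero, max_self]
  -- measurability, `L²`
  have hWm : AEStronglyMeasurable (fun x ↦ ((W x : ℝ) : ℂ)) volume := by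
    refine Complex.continuous_ofReal.comp_aestronglyMeasurable ?_
    have h1 : AEStronglyMeasurable (fun x ↦ (v x).re - K₁ * B x) volume :=
      (Complex.continuous_re.comp_aestronglyMeasurable hv.memLp.1).sub
        (hBm.const_mul K₁).aestronglyMeasurable
    exact h1.sup aestronglyMeasurable_const
  have hWC : MemLp (fun x ↦ ((W x : ℝ) : ℂ)) 2 := by
    refine MemLp.of_le hv.memLp hWm (Eventually.of_forall fun x ↦ ?_)
    rw [Complex.norm_real, Real.norm_of_nonneg (hW0 x)]
    exact hWle x
  have hWr : MemLp W 2 := by simpa using hWC.re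
  have hWCsupp : ∀ᵐ x : ℝ, x ∉ Icc (-a) a → ((W x : ℝ) : ℂ) = 0 :=
    Eventually.of_forall fun x hx ↦ by rw [hWsupp x hx, Complex.ofReal_zero]
  -- finite energy
  have hfinV := (oddGroundState_finiteEnergy' a v hv).1
  have hDle := stub_comparison_weilIncrement_le (K₁ := K₁) hv.memLp hB2 hWC hWdef
  have hfinW : IntegrableOn
      (fun t ↦ weilArchDensity t * weilIncrement (fun x ↦ ((W x : ℝ) : ℂ)) t) (Ioi 0) := by
    refine Integrable.mono' ((hfinV.const_mul 2).add (hBE.const_mul (2 * K₁ ^ 2)))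
      (measurable_weilArchDensity.aestronglyMeasurable.mul
        (stub_supBound_aesm_weilIncrement hWC.1).restrict) ?_
    refine (ae_restrict_iff' measurableSet_Ioi).2 (Eventually.of_forall fun t (ht : 0 < t) ↦ ?_)
    rw [Real.norm_of_nonneg (mul_nonneg (weilArchDensity_pos ht).le (weilIncrement_nonneg _ t))]
    have := mul_le_mul_of_nonneg_left (hDle t) (weilArchDensity_pos ht).le
    simp only [Pi.add_apply]
    linarith
  -- integrability of `v`, `W`
  have hv1 : Integrable v := hv.integrable
  have hWC1 : Integrable (fun x ↦ ((W x : ℝ) : ℂ)) := by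
    refine Integrable.mono' hv1.norm hWm (Eventually.of_forall fun x ↦ ?_)
    rw [Complex.norm_real, Real.norm_of_nonneg (hW0 x)]
    exact hWle x
  have hW1 : Integrable W := by simpa using hWC1.re
  -- the Euler–Lagrange identity against `W`, real part
  have hid := oddGroundState_eulerLagrange_all a v hv
    (fun x ↦ ((W x : ℝ) : ℂ)) hWC hWCsupp hfinW
  have hre := congrArg Complex.re hid
  simp only [Complex.sub_re, Complex.add_re, Complex.re_ofReal_mul] at hre
  have hpair : (∫ x, v x * conj ((W x : ℝ) : ℂ)).re = ∫ x, (v x).re * W x :=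
    stub_supBound_re_integral_mul_conj_ofReal (hv.memLp.integrable_mul hWC)
  rw [hpair] at hre
  -- pole and primes
  have hpole := stub_comparison_pole_re_lower haA hv1 hv0 hWC1 hWsupp
  have hsum := stub_comparison_sum_re_lower hv.memLp hWC hW1 hWdef hK₁ hBb (weilPrimeIndex a)
  -- the archimedean term: real part, and the barrier lower bound
  obtain ⟨hXint, harch⟩ := stub_supBound_arch_re hv.memLp hWC hfinV hfinW
  obtain ⟨hYint, -⟩ := stub_supBound_arch_re hB2 hWC hBE hfinW
  simp only [Complex.ofReal_re] at hYint
  have hBr : MemLp B 2 := by simpa using hB2.re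
  have hXY : ∀ t, K₁ * ∫ x, (B (x + t) - B x) * (W (x + t) - W x) ≤
      ∫ x, ((v (x + t)).re - (v x).re) * (W (x + t) - W x) := by
    intro t
    rw [← integral_const_mul]
    have hWt : MemLp (fun x ↦ W (x + t) - W x) 2 :=
      (hWr.comp_measurePreserving (measurePreserving_add_right volume t)).sub hWr
    have iY : Integrable (fun x ↦ K₁ * ((B (x + t) - B x) * (W (x + t) - W x))) :=
      (((hBr.comp_measurePreserving (measurePreserving_add_right volume t)).sub hBr).integrable_mul
        hWt).const_mul K₁
    have iX : Integrable (fun x ↦ ((v (x + t)).re - (v x).re) * (W (x + t) - W x)) := by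
      have h1 : MemLp (fun x ↦ v (x + t) - v x) 2 :=
        (hv.memLp.comp_measurePreserving (measurePreserving_add_right volume t)).sub hv.memLp
      have h3 : MemLp (fun x ↦ (v (x + t) - v x).re) 2 := by simpa using h1.re
      refine (h3.integrable_mul hWt).congr (Eventually.of_forall fun x ↦ ?_)
      simp only [Pi.mul_apply, Complex.sub_re]
    refine integral_mono iY iX fun x ↦ ?_
    have h := (stub_comparison_markovB (R := fun y ↦ (v y).re) hK₁ hBb (x + t) x).1
    simpa only [hWdef] using h
  have harch_low : K₁ * (c * sL * ∫ x, W x) ≤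
      ∫ t in Ioi (0 : ℝ), weilArchDensity t *
        ∫ x, ((v (x + t)).re - (v x).re) * (W (x + t) - W x) := by
    have hWae0 : ∀ᵐ x : ℝ, 0 ≤ W x := Eventually.of_forall hW0
    have hWlayer : ∀ᵐ x : ℝ, ¬(a - d₀ < |x| ∧ |x| < a) → W x = 0 := by
      filter_upwards [hvb, Measure.ae_ne volume a, Measure.ae_ne volume (-a)] with x hx hxa hxna
      intro hnl
      by_cases h1 : |x| < a
      · have h2 : |x| ≤ a - d₀ := by
          by_contra h3
          exact hnl ⟨lt_of_not_ge h3, h1⟩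
        have h4 : K₁ * B x = Csup := by rw [hBp x h2, hK₁β₀]
        rw [hWdef, h4]
        exact max_eq_right (by linarith [Complex.abs_re_le_norm (v x), le_abs_self ((v x).re)])
      · apply hWsupp
        intro hxI
        have h5 : |x| ≤ a := abs_le.2 ⟨hxI.1, hxI.2⟩
        have h6 : |x| = a := le_antisymm h5 (not_lt.1 h1)
        rcases le_or_gt 0 x with h7 | h7
        · rw [abs_of_nonneg h7] at h6; exact hxa h6
        · rw [abs_of_neg h7] at h6; exact hxna (by linarith)
    have hw := hweak W hWr hWae0 hWlayer
    calc K₁ * (c * sL * ∫ x, W x)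
        ≤ K₁ * ∫ t in Ioi (0 : ℝ), weilArchDensity t *
            ∫ x, (B (x + t) - B x) * (W (x + t) - W x) :=
          mul_le_mul_of_nonneg_left hw hK₁
      _ = ∫ t in Ioi (0 : ℝ), weilArchDensity t *
            (K₁ * ∫ x, (B (x + t) - B x) * (W (x + t) - W x)) := by
          rw [← integral_const_mul]
          refine integral_congr_ae (Eventually.of_forall fun t ↦ ?_)
          ring
      _ ≤ ∫ t in Ioi (0 : ℝ), weilArchDensity t *
            ∫ x, ((v (x + t)).re - (v x).re) * (W (x + t) - W x) := by
          refine integral_mono_ae ?_ hXint ?_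
          · have := hYint.const_mul K₁
            refine this.congr (Eventually.of_forall fun t ↦ ?_)
            show K₁ * (weilArchDensity t * _) = _
            ring
          · refine (ae_restrict_iff' measurableSet_Ioi).2
              (Eventually.of_forall fun t (ht : 0 < t) ↦ ?_)
            exact mul_le_mul_of_nonneg_left (hXY t) (weilArchDensity_pos ht).le
  rw [harch] at hre
  -- the numbers
  have hS0 : 0 ≤ ∫ x, W x := integral_nonneg hW0
  have hNW : ∫ x, ‖((W x : ℝ) : ℂ)‖ = ∫ x, W x :=
    integral_congr_ae (Eventually.of_forall fun x ↦ by
      show ‖((W x : ℝ) : ℂ)‖ = W x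
      rw [Complex.norm_real, Real.norm_of_nonneg (hW0 x)])
  have hNu : ∫ x, ‖v x‖ ≤ A + 1 / 2 := (oddComparison_l1_le hv hv0).trans (by linarith)
  -- killing: `0 ≤ ∫ Re v · W ≤ Csup ∫ W`
  have hIlow : 0 ≤ ∫ x, (v x).re * W x := by
    have h1 : ∀ x, 0 ≤ (v x).re * W x := by
      intro x
      have h2 := stub_comparison_mul_trunc_le ((v x).re) (K₁ * B x)
      rw [hWdef]
      exact le_trans (mul_nonneg (mul_nonneg hK₁ (hBb x).1) (le_max_right _ _)) h2
    exact integral_nonneg h1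
  have hIup : ∫ x, (v x).re * W x ≤ Csup * ∫ x, W x := by
    rw [← integral_const_mul]
    refine integral_mono_ae (by simpa using (hv.memLp.integrable_mul hWC).re) (hW1.const_mul Csup) ?_
    filter_upwards [hvb] with x hx
    exact mul_le_mul_of_nonneg_right
      ((le_abs_self _).trans ((Complex.abs_re_le_norm (v x)).trans hx)) (hW0 x)
  rw [hNW] at hpole
  have hp1 : 4 * Real.exp A ^ 2 * (∫ x, ‖v x‖) * (∫ x, W x) ≤
      4 * Real.exp A ^ 2 * (A + 1 / 2) * ∫ x, W x :=
    mul_le_mul_of_nonneg_right (mul_le_mul_of_nonneg_left hNu (by positivity)) hS0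
  have hM : weilMarkovConstant a * ∫ x, (v x).re * W x ≤
      |weilMarkovConstant a| * (Csup * ∫ x, W x) :=
    (le_abs_self _).trans (by rw [abs_mul, abs_of_nonneg hIlow]; exact
      mul_le_mul_of_nonneg_left hIup (abs_nonneg _))
  have hE : weilOddGroundEnergy a * ∫ x, (v x).re * W x ≤
      |weilOddGroundEnergy a| * (Csup * ∫ x, W x) :=
    (le_abs_self _).trans (by rw [abs_mul, abs_of_nonneg hIlow]; exact
      mul_le_mul_of_nonneg_left hIup (abs_nonneg _))
  have hSA0 : 0 ≤ ∑ n ∈ weilPrimeIndex a, (ArithmeticFunction.vonMangoldt n : ℝ) / Real.sqrt n :=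
    Finset.sum_nonneg fun n _ ↦ div_nonneg ArithmeticFunction.vonMangoldt_nonneg (Real.sqrt_nonneg _)
  have hK₁c : K₁ * (c * sL * ∫ x, W x) = Csup * (c * L₀) * ∫ x, W x := by
    rw [hK₁def, ← hsL2]; ring
  rw [hK₁c] at harch_low
  have h2K : 2 * K₁ * (1 / sL) = 2 * Csup := by rw [mul_assoc, hK₁β₀]
  rw [h2K] at hsum
  -- abbreviations for the bookkeeping
  set S : ℝ := ∫ x, W x with hSdef
  set P : ℝ := 4 * Real.exp A ^ 2 * (A + 1 / 2) with hPdef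
  set Sa : ℝ := ∑ n ∈ weilPrimeIndex a, (ArithmeticFunction.vonMangoldt n : ℝ) / Real.sqrt n
    with hSadef
  have hA : 0 < A := hv.pos.trans_le haA
  have hP0 : 0 ≤ P := by positivity
  -- upper bound of the archimedean term from the identity
  have hup : ∫ t in Ioi (0 : ℝ), weilArchDensity t *
        ∫ x, ((v (x + t)).re - (v x).re) * (W (x + t) - W x) ≤
      |weilMarkovConstant a| * (Csup * S) + |weilOddGroundEnergy a| * (Csup * S) + P * S +
        2 * Csup * S * Sa := by
    linarith [hre, hpole, hp1, hsum, hM, hE]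
  have hPS : P * S ≤ Csup * (P * S) := le_mul_of_one_le_left (mul_nonneg hP0 hS0) hCsup1
  have hkey : Csup * (c * L₀) * S ≤ Csup * CF * S := by
    have h3 : |weilMarkovConstant a| * (Csup * S) + |weilOddGroundEnergy a| * (Csup * S) +
        Csup * (P * S) + 2 * Csup * S * Sa =
        Csup * S * (|weilMarkovConstant a| + |weilOddGroundEnergy a| + P + 2 * Sa) := by ring
    have h4 : Csup * S * (|weilMarkovConstant a| + |weilOddGroundEnergy a| + P + 2 * Sa) ≤
        Csup * S * CF := mul_le_mul_of_nonneg_left hCF (mul_nonneg hCsup0.le hS0)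
    have h5 : Csup * S * CF = Csup * CF * S := by ring
    linarith [harch_low, hup, hPS, h3, h4, h5]
  have hlow : Csup * (CF + 1) * S ≤ Csup * (c * L₀) * S :=
    mul_le_mul_of_nonneg_right (mul_le_mul_of_nonneg_left hL₀ hCsup0.le) hS0
  have hsplit : Csup * (CF + 1) * S = Csup * CF * S + Csup * S := by ring
  have hCS : Csup * S ≤ 0 := by linarith [hkey, hlow, hsplit]
  have hSz : S = 0 := by
    apply le_antisymm _ hS0
    by_contra h
    have h' : 0 < S := lt_of_not_ge h
    linarith [mul_pos hCsup0 h']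
  -- conclusion
  have hWae : W =ᵐ[volume] 0 := (integral_eq_zero_iff_of_nonneg hW0 hW1).1 hSz
  filter_upwards [hWae] with x hx
  have hx' : max ((v x).re - K₁ * B x) 0 = 0 := hx
  have := le_max_left ((v x).re - K₁ * B x) 0
  rw [hx'] at this
  linarith

end Summit.RiemannHypothesis.RiemannHypothesis.Theorems.OddSectorWindowLipschitz

end
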